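/-
Copyright (c) 2026 the pub-hodgecm-mathlib formalisation cell (harness21).  Prover seat hodgecm-mathlib-K2E5-p17 (g3) (free E5 hand on the E3 road),
Track B «K2-LIT» ∕ h413 (`stmt-HodgeConjecture-24833`), line `K2_E3_EllipticInputs`, unit U12-d, §L road «U-iso-T», brick (G⁺-b) LINE SIDE, part 5b:
(T1)∕(T2) for RAMIFIED quadratic characters and the combined statement for every non-trivial quadratic character.  2026-09-04.
-/
import Summits.HodgeConjecture.HodgeConjecture.Theorems.K2E3LocalFieldQuadraticCharRamifiedLemmas   -- ★ part 5a: per-coset identity, ramified shells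
import HarnessLib

/-!
# K2_E3 road (h413), §L — (G⁺-b) line side, part 5b: (T1)∕(T2), ramified case, and the COMBINED quadratic-character statement

Cell `pub/hodgecm-mathlib` (D-0151), Track B, seat K2E5-p17 (g3) ((G⁺-b) cut with K2E5-p10 (g4)); frozen interface K2 bus 04:26:40Z + ERRATUM 04:38:32Z.
`--supports stmt-HodgeConjecture-24833 --as helper`; THEOREMS ONLY.  COUNT-NEUTRAL.

* §1 integrability of the regularised coset integrand for any bounded measurable weight;
* §2 **(T1), ramified quadratic `χ`** `integral_extend_mul_fourierSB_eq_of_ramified`: `∫ χ̃ Ĝ dμ = g · Z₀(G)`, `g = ∫_{shell m−c} ψ χ̃` (Gauss sum), no `δ₀` term;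
* §3 **(T2), ramified** `setIntegral_compl_primePowBall_eventually_eq_of_ramified`: EVERY truncation `(𝔭^n)ᶜ` beyond the constancy ball is exact;
* §4 **THE FROZEN (G⁺-b) LINE-SIDE INTERFACE, all non-trivial quadratic `χ`**: `exists_lineInversion_consts_of_quadratic` ((T1) `∃ γ₀ c₀`, with the constants
  pinned in each case) and `exists_forall_setIntegral_compl_primePowBall_even_eq_of_quadratic` ((T2), `∃ N₀, ∀ n ≥ N₀` form of the even truncations).
[Tate1950, §2.3, §2.5] [BushnellHenniart2006, §23.5, §23.6].
HONEST LABEL: HC_CM is proved only modulo the 7 printed citations (2 remaining named inputs: hLiu418 = stmt-HodgeConjecture-24832, h413 = stmt-HodgeConjecture-24833)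
until rung 0 closes; count-neutral.
-/

set_option autoImplicit false
set_option linter.dupNamespace false   -- `Summit.HodgeConjecture.HodgeConjecture.…` (D-0017 nested layout; lakefile exemption for Summits)

noncomputable section

open MeasureTheory Measure Filter Topology Set
open scoped NNReal ENNReal Pointwise
open Literature.NumberTheory.Automorphic Literature.NumberTheory.Automorphic.LocalFieldHaar Literature.NumberTheory.Automorphic.TateDirect
open Literature.NumberTheory.GaloisRepresentations Literature.NumberTheory.GaloisRepresentations.IsNonarchimedeanLocalField
open Summit.HodgeConjecture.HodgeConjecture.Cruxes.H413.K2E3LocalFieldSignCharLineLemmas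
open Summit.HodgeConjecture.HodgeConjecture.Cruxes.H413.K2E3LocalFieldSignCharZetaBalls
open Summit.HodgeConjecture.HodgeConjecture.Cruxes.H413.K2E3LocalFieldQuadraticCharLineInversion
open Summit.HodgeConjecture.HodgeConjecture.Cruxes.H413.K2E3LocalFieldQuadraticCharSignWeight
open Summit.HodgeConjecture.HodgeConjecture.Cruxes.H413.K2E3LocalFieldQuadraticCharRamifiedLemmas

namespace Summit.HodgeConjecture.HodgeConjecture.Cruxes.H413.K2E3LocalFieldQuadraticCharLineInversionRamified

variable {F : Type*} [Field F] [ValuativeRel F] [TopologicalSpace F] [IsNonarchimedeanLocalField F] [MeasurableSpace F] [BorelSpace F]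
  (μ : Measure F) [μ.IsAddHaarMeasure]

/-! ## §1  Integrability of the regularised coset integrand (bounded measurable weight) -/

open scoped Classical in
/-- For any bounded measurable weight `X`, `X n (1_B − 1_𝒪 1_B(0))` is integrable for a coset `B = a + 𝔭^N`. [folklore] -/
theorem integrable_mul_normInv_mul_indicator_of_eq {X : F → ℂ} (hXm : Measurable X) (hXb : ∀ x, ‖X x‖ ≤ 1)
    {B : Set F} {a : F} {N : ℤ} (hB : B = a +ᵥ primePowBall F N) :
    Integrable (fun s => X s * ((((normAbs F s)⁻¹ : ℝ≥0) : ℝ) : ℂ) *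
      (B.indicator (fun _ => (1 : ℂ)) s - (primePowBall F 0).indicator (fun _ => B.indicator (fun _ => (1 : ℂ)) 0) s)) μ := by
  subst hB
  by_cases ha : a ∈ primePowBall F N
  · rw [vadd_primePowBall_eq_self ha, Set.indicator_of_mem (zero_mem_primePowBall N)]
    rcases le_or_gt 0 N with hN | hN
    · obtain ⟨k, rfl⟩ := Int.eq_ofNat_of_zero_le hN
      have h : (fun s => X s * ((((normAbs F s)⁻¹ : ℝ≥0) : ℝ) : ℂ) *
          ((primePowBall F (k : ℤ)).indicator (fun _ => (1 : ℂ)) s - (primePowBall F 0).indicator (fun _ => (1 : ℂ)) s)) =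
          fun s => -((primePowBall F 0 \ primePowBall F (k : ℤ)).indicator (fun s => X s * ((((normAbs F s)⁻¹ : ℝ≥0) : ℝ) : ℂ)) s) := by
        funext s
        by_cases h0 : s ∈ primePowBall F 0
        · by_cases hk : s ∈ primePowBall F (k : ℤ)
          · simp [h0, hk]
          · simp [h0, hk]
        · have hk : s ∉ primePowBall F (k : ℤ) := fun h => h0 (primePowBall_antitone (by omega) h)
          simp [h0, hk]
      rw [h]
      exact ((integrable_indicator_iff ((measurableSet_primePowBall 0).diff (measurableSet_primePowBall _))).2
        (integrableOn_sign_mul_normInv μ hXm hXb 0 k)).neg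
    · obtain ⟨k, rfl⟩ : ∃ k : ℕ, N = -(k : ℤ) := ⟨(-N).toNat, by omega⟩
      have h : (fun s => X s * ((((normAbs F s)⁻¹ : ℝ≥0) : ℝ) : ℂ) *
          ((primePowBall F (-(k : ℤ))).indicator (fun _ => (1 : ℂ)) s - (primePowBall F 0).indicator (fun _ => (1 : ℂ)) s)) =
          (primePowBall F (-(k : ℤ)) \ primePowBall F 0).indicator (fun s => X s * ((((normAbs F s)⁻¹ : ℝ≥0) : ℝ) : ℂ)) := by
        funext s
        by_cases hk : s ∈ primePowBall F (-(k : ℤ))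
        · by_cases h0 : s ∈ primePowBall F 0
          · simp [h0, hk]
          · simp [h0, hk]
        · have h0 : s ∉ primePowBall F 0 := fun h => hk (primePowBall_antitone (by omega) h)
          simp [h0, hk]
      rw [h]
      exact (integrable_indicator_iff ((measurableSet_primePowBall _).diff (measurableSet_primePowBall 0))).2
        (integrableOn_sign_mul_normInv μ hXm hXb _ 0)
  · have ha0 : a ≠ 0 := fun h => ha (h ▸ zero_mem_primePowBall N)
    obtain ⟨v, hv⟩ := exists_normAbs_eq_inv_zpow ha0
    have ha' : a ∉ primePowBall F N := ha
    have h0B : (0 : F) ∉ a +ᵥ primePowBall F N := fun h => by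
      rw [mem_vadd_primePowBall_iff, zero_sub] at h
      exact ha (by simpa using neg_mem_primePowBall h)
    have hshell : ∀ s ∈ a +ᵥ primePowBall F N, s ∈ primePowBall F v \ primePowBall F (v + 1) := fun s hs => by
      rw [mem_shell_iff, normAbs_eq_of_sub_mem ha' ((mem_vadd_primePowBall_iff).1 hs), hv]
    have h : (fun s => X s * ((((normAbs F s)⁻¹ : ℝ≥0) : ℝ) : ℂ) *
        ((a +ᵥ primePowBall F N).indicator (fun _ => (1 : ℂ)) s -
          (primePowBall F 0).indicator (fun _ => (a +ᵥ primePowBall F N).indicator (fun _ => (1 : ℂ)) 0) s)) =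
        (a +ᵥ primePowBall F N).indicator (fun s => X s * ((((normAbs F s)⁻¹ : ℝ≥0) : ℝ) : ℂ)) := by
      funext s
      have h0 : (a +ᵥ primePowBall F N).indicator (fun _ => (1 : ℂ)) 0 = 0 := by simp [h0B]
      have h0' : (primePowBall F 0).indicator (fun _ => (a +ᵥ primePowBall F N).indicator (fun _ => (1 : ℂ)) 0) s = 0 := by
        rw [h0]; exact Set.indicator_apply_eq_zero.2 fun _ => rfl
      rw [h0', sub_zero]
      by_cases hs : s ∈ a +ᵥ primePowBall F N
      · rw [Set.indicator_of_mem hs, Set.indicator_of_mem hs, mul_one]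
      · simp [hs]
    rw [h]
    exact (integrable_indicator_iff (measurableSet_vadd_primePowBall N a)).2
      ((integrableOn_sign_mul_normInv μ hXm hXb v (v + 1)).mono_set fun s hs => hshell s hs)

/-! ## §2  (T1), ramified case -/

section Ramified
variable (χ : QuasiChar F) (hχr : ¬ χ.IsUnramified) (hχ2 : ∀ u, χ u * χ u = 1) {c : ℕ} (hc : χ.HasConductorExp c)
  (ψ : AddChar F Circle) (hψc : Continuous ψ) {m : ℤ} (hm : ψ.HasConductorExp m)

open scoped Classical in
include hχr hχ2 hc hψc hm in
/-- **(T1), ramified quadratic `χ` of conductor exponent `c`.**  For every Schwartz–Bruhat `G`,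
`∫ χ̃(t) Ĝ(t) dμ = g · Z₀(G)`, `g = ∫_{shell m−c} ψ χ̃` the Gauss sum, `Z₀(G) = ∫ χ̃(s) ‖s‖⁻¹ (G s − 1_𝒪(s) G 0) dμ` — no `δ₀` term.
[cite: Tate1950, §2.5] [cite: BushnellHenniart2006, §23.6] -/
theorem integral_extend_mul_fourierSB_eq_of_ramified {G : F → ℂ} (hG : G ∈ SchwartzBruhat F) :
    ∫ t, Function.extend ((↑) : Fˣ → F) (fun u => ((χ u : ℂˣ) : ℂ)) 0 t * fourierSB ψ μ G t ∂μ =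
      (∫ x in primePowBall F (m - c) \ primePowBall F (m - c + 1),
          (ψ x : ℂ) * Function.extend ((↑) : Fˣ → F) (fun u => ((χ u : ℂˣ) : ℂ)) 0 x ∂μ) *
        ∫ s, Function.extend ((↑) : Fˣ → F) (fun u => ((χ u : ℂˣ) : ℂ)) 0 s * ((((normAbs F s)⁻¹ : ℝ≥0) : ℝ) : ℂ) *
          (G s - (primePowBall F 0).indicator (fun _ => G 0) s) ∂μ := by
  have hXm : Measurable (Function.extend ((↑) : Fˣ → F) (fun u => ((χ u : ℂˣ) : ℂ)) 0) := measurable_extend χ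
  have hXb := norm_extend_le_one χ hχ2
  obtain ⟨N, C, rep, hrep, hsum⟩ := exists_finset_eq_sum_const_mul_indicator hG
  have hGf : G = fun u => ∑ B ∈ C, G (rep B) * B.indicator (fun _ => (1 : ℂ)) u := funext hsum
  have hF : fourierSB ψ μ G = fun y => ∑ B ∈ C, G (rep B) * fourierSB ψ μ (B.indicator fun _ => (1 : ℂ)) y := by
    rw [congrArg (fourierSB ψ μ) hGf,
      fourierSB_finset_sum μ hψc C (fun B u => G (rep B) * B.indicator (fun _ => (1 : ℂ)) u)
        (fun B hB => integrable_const_mul_indicator_of_eq μ (hrep B hB) _)]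
    funext y
    refine Finset.sum_congr rfl fun B _ => ?_
    rw [fourierSB_const_mul]
  have hLHS : ∫ t, Function.extend ((↑) : Fˣ → F) (fun u => ((χ u : ℂˣ) : ℂ)) 0 t * fourierSB ψ μ G t ∂μ =
      ∑ B ∈ C, G (rep B) * ∫ t, Function.extend ((↑) : Fˣ → F) (fun u => ((χ u : ℂˣ) : ℂ)) 0 t *
        fourierSB ψ μ (B.indicator fun _ => (1 : ℂ)) t ∂μ := by
    rw [hF]
    simp_rw [Finset.mul_sum]
    rw [integral_finsetSum C (fun B hB => ?_)]
    · refine Finset.sum_congr rfl fun B _ => ?_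
      rw [← integral_const_mul]
      refine integral_congr_ae (Filter.Eventually.of_forall fun t => ?_)
      simp only
      ring
    · have hi : Integrable (fourierSB ψ μ (B.indicator fun _ => (1 : ℂ))) μ := by
        rw [hrep B hB]; exact integrable_fourierSB_indicator_vadd_primePowBall μ hψc hm (rep B) N
      exact (hi.const_mul (G (rep B))).bdd_mul (c := 1) hXm.aestronglyMeasurable (Filter.Eventually.of_forall hXb)
  have hZf : (fun s => Function.extend ((↑) : Fˣ → F) (fun u => ((χ u : ℂˣ) : ℂ)) 0 s * ((((normAbs F s)⁻¹ : ℝ≥0) : ℝ) : ℂ) *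
        (G s - (primePowBall F 0).indicator (fun _ => G 0) s)) =
      fun s => ∑ B ∈ C, G (rep B) * (Function.extend ((↑) : Fˣ → F) (fun u => ((χ u : ℂˣ) : ℂ)) 0 s * ((((normAbs F s)⁻¹ : ℝ≥0) : ℝ) : ℂ) *
        (B.indicator (fun _ => (1 : ℂ)) s - (primePowBall F 0).indicator (fun _ => B.indicator (fun _ => (1 : ℂ)) 0) s)) := by
    funext s
    have h1 : (primePowBall F 0).indicator (fun _ => G 0) s =
        ∑ B ∈ C, G (rep B) * (primePowBall F 0).indicator (fun _ => B.indicator (fun _ => (1 : ℂ)) 0) s := by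
      by_cases hs : s ∈ primePowBall F 0
      · simp_rw [Set.indicator_of_mem hs]; exact hsum 0
      · simp [hs]
    rw [hsum s, h1, ← Finset.sum_sub_distrib, Finset.mul_sum]
    refine Finset.sum_congr rfl fun B _ => ?_
    ring
  have hRHS : ∫ s, Function.extend ((↑) : Fˣ → F) (fun u => ((χ u : ℂˣ) : ℂ)) 0 s * ((((normAbs F s)⁻¹ : ℝ≥0) : ℝ) : ℂ) *
        (G s - (primePowBall F 0).indicator (fun _ => G 0) s) ∂μ =
      ∑ B ∈ C, G (rep B) * ∫ s, Function.extend ((↑) : Fˣ → F) (fun u => ((χ u : ℂˣ) : ℂ)) 0 s * ((((normAbs F s)⁻¹ : ℝ≥0) : ℝ) : ℂ) *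
        (B.indicator (fun _ => (1 : ℂ)) s - (primePowBall F 0).indicator (fun _ => B.indicator (fun _ => (1 : ℂ)) 0) s) ∂μ := by
    rw [hZf, integral_finsetSum C (fun B hB => (integrable_mul_normInv_mul_indicator_of_eq μ hXm hXb (hrep B hB)).const_mul _)]
    refine Finset.sum_congr rfl fun B _ => ?_
    rw [integral_const_mul]
  rw [hLHS, hRHS, Finset.mul_sum]
  refine Finset.sum_congr rfl fun B hB => ?_
  have key := integral_extend_mul_fourierSB_indicator_vadd_eq μ χ hχr hχ2 hc ψ hψc hm (rep B) N
  rw [← hrep B hB] at key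
  rw [key]
  ring

/-! ## §3  (T2), ramified case -/

open scoped Classical in
include hχr hχ2 in
/-- **(T2), ramified quadratic `χ` — EVERY truncation.**  Eventually in `n`, `∫_{(𝔭^{n})ᶜ} χ̃(s) ‖s‖⁻¹ G(s) dμ = Z₀(G)` exactly, for all (not only even)
exponents: the `G(0)`-term over `𝒪 ∖ 𝔭^{n}` vanishes shell by shell. [cite: Tate1950, §2.5] -/
theorem setIntegral_compl_primePowBall_eventually_eq_of_ramified {G : F → ℂ} (hG : G ∈ SchwartzBruhat F) :
    ∀ᶠ n : ℕ in atTop, ∫ s in (primePowBall F (n : ℤ))ᶜ,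
        Function.extend ((↑) : Fˣ → F) (fun u => ((χ u : ℂˣ) : ℂ)) 0 s * ((((normAbs F s)⁻¹ : ℝ≥0) : ℝ) : ℂ) * G s ∂μ =
      ∫ s, Function.extend ((↑) : Fˣ → F) (fun u => ((χ u : ℂˣ) : ℂ)) 0 s * ((((normAbs F s)⁻¹ : ℝ≥0) : ℝ) : ℂ) *
        (G s - (primePowBall F 0).indicator (fun _ => G 0) s) ∂μ := by
  haveI : T2Space F := (isLocalField F).toT2Space
  haveI : LocallyCompactSpace F := (isLocalField F).toLocallyCompactSpace
  have hXm : Measurable (Function.extend ((↑) : Fˣ → F) (fun u => ((χ u : ℂˣ) : ℂ)) 0) := measurable_extend χ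
  have hXb := norm_extend_le_one χ hχ2
  obtain ⟨N, hN⟩ := exists_forall_add_eq_of_mem_schwartzBruhat hG
  have hGi : Integrable G μ := ((mem_schwartzBruhat_iff).1 hG).1.continuous.integrable_of_hasCompactSupport ((mem_schwartzBruhat_iff).1 hG).2
  refine Filter.eventually_atTop.2 ⟨N.toNat, fun n hn => ?_⟩
  have h2n : N ≤ (n : ℤ) := by have := Int.self_le_toNat N; omega
  have hvan : ∀ s, s ∉ (primePowBall F (n : ℤ))ᶜ →
      Function.extend ((↑) : Fˣ → F) (fun u => ((χ u : ℂˣ) : ℂ)) 0 s * ((((normAbs F s)⁻¹ : ℝ≥0) : ℝ) : ℂ) *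
        (G s - (primePowBall F 0).indicator (fun _ => G 0) s) = 0 := by
    intro s hs'
    have hs : s ∈ primePowBall F (n : ℤ) := by simpa using hs'
    have hs0 : s ∈ primePowBall F 0 := primePowBall_antitone (by omega) hs
    have hsN : s ∈ primePowBall F N := primePowBall_antitone h2n hs
    have hG0 : G s = G 0 := by have := hN 0 s hsN; rwa [zero_add] at this
    rw [Set.indicator_of_mem hs0, hG0, sub_self, mul_zero]
  rw [← setIntegral_eq_integral_of_forall_compl_eq_zero hvan]
  have hmeas : MeasurableSet (primePowBall F (n : ℤ))ᶜ := (measurableSet_primePowBall _).compl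
  have hI1 : IntegrableOn (fun s => Function.extend ((↑) : Fˣ → F) (fun u => ((χ u : ℂˣ) : ℂ)) 0 s * ((((normAbs F s)⁻¹ : ℝ≥0) : ℝ) : ℂ) * G s)
      (primePowBall F (n : ℤ))ᶜ μ := by
    refine (hGi.integrableOn).bdd_mul (c := (residueFieldCard F : ℝ) ^ (n : ℤ))
      ((hXm.mul measurable_normInv).aestronglyMeasurable) ?_
    rw [ae_restrict_iff' hmeas]
    refine Filter.Eventually.of_forall fun s hs => ?_
    rw [norm_mul]
    calc ‖Function.extend ((↑) : Fˣ → F) (fun u => ((χ u : ℂˣ) : ℂ)) 0 s‖ * ‖((((normAbs F s)⁻¹ : ℝ≥0) : ℝ) : ℂ)‖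
          ≤ 1 * (residueFieldCard F : ℝ) ^ (n : ℤ) := mul_le_mul (hXb s) (norm_normInv_le hs) (norm_nonneg _) zero_le_one
      _ = (residueFieldCard F : ℝ) ^ (n : ℤ) := one_mul _
  have hind : (fun s => Function.extend ((↑) : Fˣ → F) (fun u => ((χ u : ℂˣ) : ℂ)) 0 s * ((((normAbs F s)⁻¹ : ℝ≥0) : ℝ) : ℂ) *
        (primePowBall F 0).indicator (fun _ => G 0) s) =
      (primePowBall F 0).indicator (fun s => G 0 * (Function.extend ((↑) : Fˣ → F) (fun u => ((χ u : ℂˣ) : ℂ)) 0 s *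
        ((((normAbs F s)⁻¹ : ℝ≥0) : ℝ) : ℂ))) := by
    funext s
    by_cases hs : s ∈ primePowBall F 0
    · rw [Set.indicator_of_mem hs, Set.indicator_of_mem hs]; ring
    · simp [hs]
  have hset : (primePowBall F (n : ℤ))ᶜ ∩ primePowBall F 0 = primePowBall F 0 \ primePowBall F (0 + (n : ℕ)) := by
    rw [Set.sdiff_eq_compl_inter, zero_add]
  have hI2 : IntegrableOn (fun s => Function.extend ((↑) : Fˣ → F) (fun u => ((χ u : ℂˣ) : ℂ)) 0 s * ((((normAbs F s)⁻¹ : ℝ≥0) : ℝ) : ℂ) *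
      (primePowBall F 0).indicator (fun _ => G 0) s) (primePowBall F (n : ℤ))ᶜ μ := by
    rw [hind, IntegrableOn, integrable_indicator_iff (measurableSet_primePowBall 0), IntegrableOn,
      Measure.restrict_restrict (measurableSet_primePowBall 0), Set.inter_comm, hset]
    exact ((integrableOn_sign_mul_normInv μ hXm hXb 0 _).const_mul (G 0))
  have hzero : ∫ s in (primePowBall F (n : ℤ))ᶜ, Function.extend ((↑) : Fˣ → F) (fun u => ((χ u : ℂˣ) : ℂ)) 0 s *
      ((((normAbs F s)⁻¹ : ℝ≥0) : ℝ) : ℂ) * (primePowBall F 0).indicator (fun _ => G 0) s ∂μ = 0 := by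
    rw [hind, setIntegral_indicator (measurableSet_primePowBall 0), hset, integral_const_mul,
      setIntegral_sdiff_extend_mul_normInv_eq_zero μ χ hχr hχ2 0 n, mul_zero]
  simp_rw [mul_sub]
  rw [integral_sub hI1 hI2, hzero, sub_zero]

end Ramified

/-! ## §4  The frozen (G⁺-b) line-side interface: every non-trivial quadratic `χ` -/

section Quadratic
variable (χ : QuasiChar F) (hχ2 : ∀ u, χ u * χ u = 1) (hχ1 : ∃ u, χ u ≠ 1)
  (ψ : AddChar F Circle) (hψc : Continuous ψ) {m : ℤ} (hm : ψ.HasConductorExp m)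

open scoped Classical in
include hχ2 hχ1 hψc hm in
/-- **(T1) — THE FROZEN (G⁺-b) LINE INVERSION, every non-trivial quadratic `χ`.**  There are constants `γ₀ c₀ : ℂ` such that for every
Schwartz–Bruhat `G`, `∫ χ̃(t) Ĝ(t) dμ = γ₀ · (Z₀(G) + c₀ · G 0)` with `Z₀(G) = ∫ χ̃(s) ‖s‖⁻¹ (G s − 1_𝒪(s) G 0) dμ`
(unramified: `γ₀ = 2(−1)^m μ(𝔭^m)∕(1+q⁻¹)`, `c₀ = (1−q⁻¹)μ(𝒪)∕2`; ramified of conductor exponent `c`: `γ₀ = ∫_{shell m−c} ψ χ̃`, `c₀ = 0`).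
[cite: Tate1950, §2.5] [cite: BushnellHenniart2006, §23.5, §23.6] -/
theorem exists_lineInversion_consts_of_quadratic :
    ∃ γ₀ c₀ : ℂ,
      (χ.IsUnramified → γ₀ = 2 * (-1) ^ m * (μ.real (primePowBall F m) : ℂ) / (1 + (residueFieldCard F : ℂ)⁻¹) ∧
        c₀ = (1 - (residueFieldCard F : ℂ)⁻¹) * (μ.real (primePowBall F 0) : ℂ) / 2) ∧
      (¬ χ.IsUnramified → c₀ = 0) ∧
      ∀ G ∈ SchwartzBruhat F,
        ∫ t, Function.extend ((↑) : Fˣ → F) (fun u => ((χ u : ℂˣ) : ℂ)) 0 t * fourierSB ψ μ G t ∂μ =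
          γ₀ * ((∫ s, Function.extend ((↑) : Fˣ → F) (fun u => ((χ u : ℂˣ) : ℂ)) 0 s * ((((normAbs F s)⁻¹ : ℝ≥0) : ℝ) : ℂ) *
              (G s - (primePowBall F 0).indicator (fun _ => G 0) s) ∂μ) + c₀ * G 0) := by
  by_cases hχ : χ.IsUnramified
  · exact ⟨_, _, fun _ => ⟨rfl, rfl⟩, fun h => (h hχ).elim,
      fun _ hG => integral_extend_mul_fourierSB_eq_of_isUnramified μ χ hχ hχ2 hχ1 ψ hψc hm hG⟩
  · obtain ⟨c, hc⟩ := QuasiChar.exists_hasConductorExp χ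
    refine ⟨∫ x in primePowBall F (m - c) \ primePowBall F (m - c + 1),
        (ψ x : ℂ) * Function.extend ((↑) : Fˣ → F) (fun u => ((χ u : ℂˣ) : ℂ)) 0 x ∂μ, 0, fun h => (hχ h).elim, fun _ => rfl,
        fun G hG => ?_⟩
    rw [integral_extend_mul_fourierSB_eq_of_ramified μ χ hχ hχ2 hc ψ hψc hm hG, zero_mul, add_zero]

open scoped Classical in
include hχ2 hχ1 in
/-- **(T2) — THE FROZEN (G⁺-b) TRUNCATION IDENTITY, every non-trivial quadratic `χ`** (strict set, even exponents):
`∀ᶠ n, ∫_{(𝔭^{2n})ᶜ} χ̃(s) ‖s‖⁻¹ G(s) dμ = Z₀(G)`. [cite: Tate1950, §2.5] -/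
theorem exists_forall_setIntegral_compl_primePowBall_even_eq_of_quadratic {G : F → ℂ} (hG : G ∈ SchwartzBruhat F) :
    ∃ N₀ : ℕ, ∀ n : ℕ, N₀ ≤ n → ∫ s in (primePowBall F (2 * n : ℤ))ᶜ,
        Function.extend ((↑) : Fˣ → F) (fun u => ((χ u : ℂˣ) : ℂ)) 0 s * ((((normAbs F s)⁻¹ : ℝ≥0) : ℝ) : ℂ) * G s ∂μ =
      ∫ s, Function.extend ((↑) : Fˣ → F) (fun u => ((χ u : ℂˣ) : ℂ)) 0 s * ((((normAbs F s)⁻¹ : ℝ≥0) : ℝ) : ℂ) *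
        (G s - (primePowBall F 0).indicator (fun _ => G 0) s) ∂μ := by
  rw [← Filter.eventually_atTop]
  by_cases hχ : χ.IsUnramified
  · exact setIntegral_compl_primePowBall_even_eventually_eq_of_isUnramified μ χ hχ hχ2 hχ1 hG
  · have h := setIntegral_compl_primePowBall_eventually_eq_of_ramified μ χ hχ hχ2 hG
    rw [Filter.eventually_atTop] at h ⊢
    obtain ⟨N₀, hN₀⟩ := h
    exact ⟨N₀, fun n hn => by have := hN₀ (2 * n) (by omega); exact_mod_cast this⟩

end Quadratic

end Summit.HodgeConjecture.HodgeConjecture.Cruxes.H413.K2E3LocalFieldQuadraticCharLineInversionRamified
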